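import Summits.BirchSwinnertonDyer.BirchSwinnertonDyer.Theses.KolyvaginRoadThree
import Summits.BirchSwinnertonDyer.BirchSwinnertonDyer.Theorems.RungK2HubKoly  -- buildfix 2026-08-26: the route file stopped importing the K2@3 hub (rev of 21:08Z); this file names `X11b.multiplicativeRankOneAtThree_of_kolyRecord` from it
import HarnessLib

/-!
# Route `KolyvaginRoadThree` — the Assembly item, discharged

Cell `bsd-stepL` (run/shared/lean/pub/bsd-stepL/), seat `bsd-stepL-koly` (prover, Kolyvagin road), D-0059 ∕ D-0061
rung-K2@3 route `route-BirchSwinnertonDyer-KolyvaginRoadThree` (planner g22, born 2026-08-26; leaf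
`Summit.BirchSwinnertonDyer.Rank1Residual.X11b.MultiplicativeRankOneAtThree`; import hub
`Theorems/RungK2HubKoly.lean`, koly p410949; A1 glue `Theorems/ClassRecordThreeKolyGlue.lean`, koly p410690).

The route's `Assembly` item (`stmt-BirchSwinnertonDyer-19157`) is the implication
`ZhangSharpFrameAtThree → SchneiderTamAtThree → HalvesTamAtThree → HsiehDescentAtThree → EulerHalvesAtThree →
ShimuraDisplaysAtThree → CornerAtThree → PublishedInputsKolyThree → X11b.MultiplicativeRankOneAtThree`: pure
re-plumbing of the koly class record `Three.forall_bsdp_of_kolyRecord` (X11b/Three/ClassRecordKoly.lean, p410349)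
through the hub `X11b.multiplicativeRankOneAtThree_of_kolyRecord` (p410949), with the A1 case supplied by
`Koly.bsdp_three_onA1_of_kolyvaginFrames` (p410690) from the deciding crux, McCallum's structure theorem, the
conductor-1 conjugation record and the conductor-1 datum (the last three conjuncts of the support). This file proves it
with the SAME term the route's deciding theorem `closes` uses inline (planner g21's sketch, farm rc 0): destructure the
support conjunction, split the grouped cruxes into the record's binders by projections, apply the hub.
Nothing mathematical is claimed beyond the kernel record; the seven cruxes and the published facts remain hypotheses
of the implication. HONEST FRAMING: this closes the ASSEMBLY item only — no crux, no class of atom O2@3, no census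
word (PARTITION: O2@3 × A1 — none).

References: [McCallumLMS1991] W. G. McCallum, Kolyvagin's work on Shafarevich–Tate groups, LMS LN 153 (1991) 295–316;
[WZhang2014] W. Zhang, Camb. J. Math. 2 (2014) 191–253, Thm. 1.1; [Castella2018] F. Castella, Camb. J. Math. 6 (2018), §5.
-/

-- sibling precedent (`KatoDescentPotSupersingularAssembly.lean`): the directory name repeats the summit name
set_option linter.dupNamespace false

namespace Summit.BirchSwinnertonDyer.BirchSwinnertonDyer.Theorems

/-- **The Assembly item of route `KolyvaginRoadThree` holds**: the seven cruxes `ZhangSharpFrameAtThree`,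
`SchneiderTamAtThree`, `HalvesTamAtThree`, `HsiehDescentAtThree`, `EulerHalvesAtThree`, `ShimuraDisplaysAtThree`,
`CornerAtThree` and the support conjunction `PublishedInputsKolyThree` imply the rung-K2@3 leaf
`X11b.MultiplicativeRankOneAtThree` — by the tree's hub `X11b.multiplicativeRankOneAtThree_of_kolyRecord` (the koly
class record re-plumbed), the A1 binder being `Koly.bsdp_three_onA1_of_kolyvaginFrames` fed with the deciding crux,
the grouped cruxes split into the record's binders by projections. Same term as the route's `closes`.
[cite: McCallumLMS1991, Cor. 5.5–5.6 (pp. 310–312) (structure of Ш[p^∞] from a Kolyvagin certificate)]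
[cite: WZhang2014, Thm. 1.1 (p. 195) (shape of the Kolyvagin-conjecture input)] -/
theorem kolyvaginRoadThree_assembly_holds :
    Summit.BirchSwinnertonDyer.BirchSwinnertonDyer.Theses.KolyvaginRoadThree.Assembly := by
  intro g₁ g₂ g₃ g₄ g₅ g₆ g₇ g₈
  obtain ⟨⟨hGZ, hKo, hB, hSk, hWu, hGZK, hmod, hnf, hHL, hMaz, hPT, hFH, hBR, hSkA, hJn, hHn, hD, hpar, hMN, hH⟩,
    hMc, hrec, hKD⟩ := g₈
  exact Summit.BirchSwinnertonDyer.Rank1Residual.X11b.multiplicativeRankOneAtThree_of_kolyRecord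
    hGZ hKo hB hSk hWu hGZK hmod hnf hHL hMaz hPT hFH hBR hSkA hJn hHn hD hpar hMN hH
    (fun W _ _ hX hram htam ↦
      Summit.BirchSwinnertonDyer.Rank1Residual.X11b.Three.Koly.bsdp_three_onA1_of_kolyvaginFrames hGZ hKo hB hSk
        hGZK hmod hnf hHL hMaz hrec hMc hKD g₁ W hX hram htam)
    g₂ (fun W _ _ hX ↦ (g₄ W hX).1) (fun W _ _ hX ↦ (g₃ W hX).1) g₆
    (fun W _ _ hX ↦ (g₅ W hX).1) (fun W _ _ hX ↦ (g₅ W hX).2.1)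
    (fun W _ _ hX ↦ (g₄ W hX).2) (fun W _ _ hX ↦ (g₃ W hX).2) (fun W _ _ hX ↦ (g₅ W hX).2.2)
    (fun W _ _ ↦ (g₇ W).1) (fun W _ _ ↦ (g₇ W).2.1) (fun W _ _ ↦ (g₇ W).2.2)

end Summit.BirchSwinnertonDyer.BirchSwinnertonDyer.Theorems
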